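import Literature.NumberTheory.LFunctions.ZetaZeroHarmonicLimit
import HarnessLib

/-!
# RH-FREE — `c₁ = Σ_{γ>0} 1/γ²` as a LIMIT: Brent–Platt–Trudgian 2021 (Math. Comp. 90), Example 1 PROVED — `Σ_{T<γ≤U} 1/γ² → (log(T/2π) + 1)/(2πT) − Q(T)/T² + E₂(T)` with `|E₂(T)| ≤ (8.334 + 0.236 log T)/T³`; the constant `c₁ = 7/(32π²) + 2∫_{2π}^∞ Q/t³` and `BrentPlattTrudgian2021_cor1 ↔ |c₁ − 0.0231049931154189707889338104| ≤ 5·10⁻²⁸` («nothing here bears on the truth of RH»)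

Topic `Literature/NumberTheory/LFunctions` (RH literature-typing tranche 1, L4 "explicit zero
statistics", gen 7). Label: **RH-FREE** — unconditional statements about the ordinates of the zeros of
`ζ`. ONE definition with a body (`zetaZeroInvSqLimit`, the constant `c₁` in the closed form given by
Theorem 1 of the source at `T = 2π`) and THEOREMS; NO new named fact; standard axioms. Nothing here
bears on the truth of RH.

Source: R. P. Brent, D. J. Platt, T. S. Trudgian, *Accurate estimation of sums over zeros of the
Riemann zeta-function*, Math. Comp. 90 (2021) 2923–2935 = arXiv:2009.13791, §4 **Example 1** and
**Corollary 1** `[corpus:paper:arxiv-2009.13791 p0006]`: "We consider computation of the constant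
`c₁ := Σ_{γ>0} 1/γ² = 0.02310499…`. Taking `φ(t) = 1/t²` in Lemma 1 gives an error term
`|E(T)| ≤ A((½ + 2 log T)/T²) = (0.14 + 0.56 log T)/T²` … The corresponding error term given by
Theorem 1 is `|E₂(T)| ≤ ((4A₀ + A₁ + A₂) + 4A₁ log T)/T³ ≤ (8.334 + 0.236 log T)/T³`", and Cor. 1:
"`c₁ = 0.0231049931154189707889338104 + ϑ(5·10⁻²⁸)`" (interval arithmetic, `10¹⁰` zeros). The engine
is the tree's `BrentPlattTrudgian2021_thm1` (`ZetaZeroSumsLehmanLimits.lean`); the tree so far held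
`c₁` only through finite truncations (the named fact `BrentPlattTrudgian2021_cor1` of
`ZetaZeroSumsLehmanExplicit.lean`, and BPT 2022 Lemma 5 `BrentPlattTrudgian2022_cor1.sum_inv_sq_le`).

## What is here

* `BPT2021.integrableOn_one_div_sq_mul_log`, `BPT2021.integral_Ioi_one_div_sq_mul_log` —
  `∫_T^∞ log(t/2π)/t² dt = (log(T/2π) + 1)/T` (`T ≥ 2π`); calculus for `φ(t) = 1/t²`.
* `BrentPlattTrudgian2021_example1_tendsto` — **Example 1 / Theorem 1 for `φ(t) = 1/t²`, PROVED**: for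
  `T ≥ 2π`, `Σ_{T<γ≤U} m(ρ)/γ² → (log(T/2π) + 1)/(2πT) − Q(T)/T² + 2∫_T^∞ Q/t³` as `U → ∞`.
* `BrentPlattTrudgian2021_example1_E2` — the printed `|E₂(T)| = |2∫_T^∞ Q/t³| ≤ (8.334 + 0.236 log T)/T³`
  (`T ≥ 2π`), modulo the two named facts behind `A₀, A₁, A₂` on `[2π, ∞)` (`BrentPlattTrudgian2021_eq29`,
  `BrentPlattTrudgian2021_lemma2`), exactly as for the BAMS paper's Lemma 2 (`ZetaZeroHarmonicLimit.lean`).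
* `zetaZeroInvSqLimit` — **`c₁ := 7/(32π²) + 2∫_{2π}^∞ Q(t)/t³ dt`** (DEFINITION; `= F(2π)` of Theorem 2
  plus `(1/2π)∫_{2π}^∞ log(t/2π)/t² = 1/(4π²)`, with `Q(2π) = 1/8`), and
  `zetaZeroInvSqLimit_tendsto` — **`Σ_{0<γ≤U} m(ρ)/γ² → c₁`**; `sum_inv_sq_le_zetaZeroInvSqLimit` — every
  truncation is `≤ c₁` (monotone convergence).
* `BrentPlattTrudgian2021_cor1_iff` — the named fact `BrentPlattTrudgian2021_cor1` (typed in gen 2 as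
  "every truncation `≤ c₁⁺`, truncations come within any `ε` of `c₁⁻`") is EQUIVALENT to the bare
  enclosure `|zetaZeroInvSqLimit − 0.0231049931154189707889338104| ≤ 5·10⁻²⁸` of the defined constant.
* `zetaZeroInvSqLimit_eq_at` — the identity behind a finite computation: for `T ≥ 2π`,
  `c₁ = Σ_{0<γ≤T} m/γ² + (log(T/2π) + 1)/(2πT) − Q(T)/T² + 2∫_T^∞ Q/t³` (used by the companion numerics
  file for a kernel enclosure from the certified zeros).

## References

* R. P. Brent, D. J. Platt, T. S. Trudgian, Math. Comp. 90 (2021) 2923–2935, §4 Example 1, Cor. 1,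
  Thm 1 (1.1)–(1.3). [BrentPlattTrudgian2021]
* R. P. Brent, D. J. Platt, T. S. Trudgian, J. Number Theory 238 (2022) 740–762, Lemma 5.
  [BrentPlattTrudgian2022]
-/

noncomputable section

open Filter Set MeasureTheory intervalIntegral
open scoped Real Topology

namespace Literature.NumberTheory.LFunctions

open SchoenfeldBound

/-! ## Calculus for `φ(t) = 1/t²` -/

/-- `d/dt (1/t²) = −2/t³` on `[T₀, ∞)`, `T₀ > 0`. [cite: BrentPlattTrudgian2021, §4 Example 1 (φ(t) = 1/t²)] -/
theorem BPT2021.hasDerivAt_one_div_sq {T₀ : ℝ} (h0 : 0 < T₀) :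
    ∀ t ∈ Ici T₀, HasDerivAt (fun s : ℝ ↦ 1 / s ^ 2) (-2 / t ^ 3) t := by
  intro t ht
  have ht0 : 0 < t := h0.trans_le ht
  have h1 : HasDerivAt (fun s : ℝ ↦ s ^ 2) (2 * t) t := by simpa using hasDerivAt_pow 2 t
  have h := h1.inv (by positivity)
  have h' := h.congr_of_eventuallyEq (f₁ := fun s : ℝ ↦ 1 / s ^ 2)
    (Eventually.of_forall fun s ↦ by show 1 / s ^ 2 = (s ^ 2)⁻¹; rw [one_div])
  refine h'.congr_deriv ?_
  field_simp

/-- `d/dt (−2/t³) = 6/t⁴` on `[T₀, ∞)`, `T₀ > 0`. [cite: BrentPlattTrudgian2021, §4 Example 1 (φ(t) = 1/t²)] -/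
theorem BPT2021.hasDerivAt_neg_two_div_cube {T₀ : ℝ} (h0 : 0 < T₀) :
    ∀ t ∈ Ici T₀, HasDerivAt (fun s : ℝ ↦ -2 / s ^ 3) (6 / t ^ 4) t := by
  intro t ht
  have ht0 : 0 < t := h0.trans_le ht
  have h1 : HasDerivAt (fun s : ℝ ↦ s ^ 3) (3 * t ^ 2) t := by simpa using hasDerivAt_pow 3 t
  have h := (h1.inv (by positivity)).const_mul (-2)
  have h' := h.congr_of_eventuallyEq (f₁ := fun s : ℝ ↦ -2 / s ^ 3)
    (Eventually.of_forall fun s ↦ by show -2 / s ^ 3 = -2 * (s ^ 3)⁻¹; rw [div_eq_mul_inv])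
  refine h'.congr_deriv ?_
  field_simp
  ring

/-- `6/t⁴` is continuous on `[T₀, ∞)`, `T₀ > 0`. [cite: BrentPlattTrudgian2021, §4 Example 1 (φ(t) = 1/t²)] -/
theorem BPT2021.continuousOn_six_div_pow_four {T₀ : ℝ} (h0 : 0 < T₀) :
    ContinuousOn (fun t : ℝ ↦ 6 / t ^ 4) (Ici T₀) :=
  continuousOn_const.div (continuousOn_id.pow 4) fun t ht ↦ by
    have := h0.trans_le ht; positivity

/-- `−2/t³` is continuous on `[T₀, ∞)`, `T₀ > 0`. [cite: BrentPlattTrudgian2021, §4 Example 1 (φ(t) = 1/t²)] -/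
theorem BPT2021.continuousOn_neg_two_div_cube {T₀ : ℝ} (h0 : 0 < T₀) :
    ContinuousOn (fun t : ℝ ↦ -2 / t ^ 3) (Ici T₀) :=
  continuousOn_const.div (continuousOn_id.pow 3) fun t ht ↦ by
    have := h0.trans_le ht; positivity

/-- `t ↦ (1/t²)/t` is integrable on `(T₀, ∞)` for `T₀ > 0` (condition (5.1) for `φ(t) = 1/t²`).
[cite: BrentPlattTrudgian2021, §4 Example 1 (φ(t) = 1/t²)] -/
theorem BPT2021.integrableOn_one_div_sq_div {T₀ : ℝ} (h0 : 0 < T₀) :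
    IntegrableOn (fun t : ℝ ↦ 1 / t ^ 2 / t) (Ioi T₀) := by
  have h := integrableOn_Ioi_rpow_of_lt (by norm_num : (-3 : ℝ) < -1) h0
  refine h.congr_fun (fun t ht ↦ ?_) measurableSet_Ioi
  have ht0 : 0 < t := h0.trans ht
  show t ^ (-3 : ℝ) = 1 / t ^ 2 / t
  rw [Real.rpow_neg ht0.le, show (3 : ℝ) = (3 : ℕ) by norm_num, Real.rpow_natCast]
  field_simp

/-- `∫_T^∞ log(t/2π)/t² dt`: the antiderivative `−(log(t/2π) + 1)/t` has derivative `log(t/2π)/t²`.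
[cite: BrentPlattTrudgian2021, §4 Example 1 (φ(t) = 1/t²)] -/
theorem BPT2021.hasDerivAt_neg_log_add_one_div {t : ℝ} (ht : 0 < t) :
    HasDerivAt (fun s : ℝ ↦ -(Real.log (s / (2 * π)) + 1) / s) (1 / t ^ 2 * Real.log (t / (2 * π))) t := by
  have h2π : (0 : ℝ) < 2 * π := by positivity
  have hlog : HasDerivAt (fun s : ℝ ↦ Real.log (s / (2 * π)) + 1) (1 / t) t := by
    have h1 : HasDerivAt (fun s : ℝ ↦ s / (2 * π)) (1 / (2 * π)) t := by
      simpa using (hasDerivAt_id t).div_const (2 * π)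
    have h2 := ((Real.hasDerivAt_log (div_pos ht h2π).ne').comp t h1).add_const 1
    refine h2.congr_deriv ?_
    field_simp
  have hinv : HasDerivAt (fun s : ℝ ↦ s⁻¹) (-(t ^ 2)⁻¹) t := hasDerivAt_inv ht.ne'
  have h := (hlog.mul hinv).neg
  have h' := h.congr_of_eventuallyEq (f₁ := fun s : ℝ ↦ -(Real.log (s / (2 * π)) + 1) / s)
    (Eventually.of_forall fun s ↦ by
      show -(Real.log (s / (2 * π)) + 1) / s = -((Real.log (s / (2 * π)) + 1) * s⁻¹)
      rw [div_eq_mul_inv, neg_mul])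
  refine h'.congr_deriv ?_
  field_simp
  ring

/-- `(log(t/2π) + 1)/t → 0`. [cite: BrentPlattTrudgian2021, §4 Example 1 (φ(t) = 1/t²)] -/
theorem BPT2021.tendsto_log_add_one_div :
    Tendsto (fun t : ℝ ↦ -(Real.log (t / (2 * π)) + 1) / t) atTop (𝓝 0) := by
  have h2π : (0 : ℝ) < 2 * π := by positivity
  have h1 : Tendsto (fun t : ℝ ↦ Real.log t ^ 1 / (1 * t + 0)) atTop (𝓝 0) :=
    Real.tendsto_pow_log_div_mul_add_atTop 1 0 1 one_ne_zero
  have h2 : Tendsto (fun t : ℝ ↦ (1 - Real.log (2 * π)) / t) atTop (𝓝 0) :=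
    tendsto_const_nhds.div_atTop tendsto_id
  have h := (h1.add h2).neg
  simp only [add_zero, neg_zero] at h
  refine h.congr' ?_
  filter_upwards [eventually_gt_atTop (0 : ℝ)] with t ht
  rw [Real.log_div ht.ne' h2π.ne']
  field_simp
  ring

/-- `log(t/2π)/t²` is integrable on `(T, ∞)` for `T ≥ 2π` (the condition of Theorem 1 for `φ = 1/t²`).
[cite: BrentPlattTrudgian2021, §4 Example 1 (φ(t) = 1/t²)] -/
theorem BPT2021.integrableOn_one_div_sq_mul_log {T : ℝ} (hT : 2 * π ≤ T) :
    IntegrableOn (fun t : ℝ ↦ 1 / t ^ 2 * Real.log (t / (2 * π))) (Ioi T) := by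
  have hπ : 3 < π := Real.pi_gt_three
  have hT0 : 0 < T := by linarith
  refine integrableOn_Ioi_deriv_of_nonneg
    ((BPT2021.hasDerivAt_neg_log_add_one_div hT0).continuousAt.continuousWithinAt)
    (fun t ht ↦ BPT2021.hasDerivAt_neg_log_add_one_div (hT0.trans ht)) (fun t ht ↦ ?_)
    BPT2021.tendsto_log_add_one_div
  have ht : T < t := ht
  have hlog : 0 ≤ Real.log (t / (2 * π)) := Real.log_nonneg (by rw [le_div_iff₀ (by positivity)]; linarith)
  have : 0 < t := hT0.trans ht
  positivity

/-- `∫_T^∞ log(t/2π)/t² dt = (log(T/2π) + 1)/T` for `T ≥ 2π`. [cite: BrentPlattTrudgian2021, §4 Example 1 (φ(t) = 1/t²)] -/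
theorem BPT2021.integral_Ioi_one_div_sq_mul_log {T : ℝ} (hT : 2 * π ≤ T) :
    ∫ t in Ioi T, (1 : ℝ) / t ^ 2 * Real.log (t / (2 * π)) = (Real.log (T / (2 * π)) + 1) / T := by
  have hπ : 3 < π := Real.pi_gt_three
  have hT0 : 0 < T := by linarith
  have h := integral_Ioi_of_hasDerivAt_of_nonneg
    ((BPT2021.hasDerivAt_neg_log_add_one_div hT0).continuousAt.continuousWithinAt)
    (fun t ht ↦ BPT2021.hasDerivAt_neg_log_add_one_div (hT0.trans ht)) (fun t ht ↦ ?_)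
    BPT2021.tendsto_log_add_one_div
  · rw [h]; ring
  · have ht : T < t := ht
    have hlog : 0 ≤ Real.log (t / (2 * π)) :=
      Real.log_nonneg (by rw [le_div_iff₀ (by positivity)]; linarith)
    have : 0 < t := hT0.trans ht
    positivity

/-- `∫_T^∞ Q(t)·(−2/t³) dt = −2∫_T^∞ Q(t)/t³ dt`. [cite: BrentPlattTrudgian2021, §4 Example 1 (φ(t) = 1/t²)] -/
theorem BPT2021.integral_Ioi_mul_neg_two_div_cube (T : ℝ) :
    ∫ t in Ioi T, ((zetaZeroCount t : ℝ) - countMain t) * (-2 / t ^ 3) =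
      -(2 * ∫ t in Ioi T, ((zetaZeroCount t : ℝ) - countMain t) / t ^ 3) := by
  rw [← MeasureTheory.integral_const_mul, ← MeasureTheory.integral_neg]
  refine setIntegral_congr_fun measurableSet_Ioi fun t _ ↦ ?_
  ring

/-! ## Example 1: `Σ_{T<γ} 1/γ²` by Theorem 1 -/

/-- **Brent–Platt–Trudgian 2021, Example 1 (Theorem 1 with `φ(t) = 1/t²`), PROVED**: for `T ≥ 2π`,
`Σ_{T<γ≤U} m(ρ)/γ² → (log(T/2π) + 1)/(2πT) − Q(T)/T² + 2∫_T^∞ Q(t)/t³ dt` as `U → ∞`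
(`(1/2π)∫_T^∞ log(t/2π)/t² = (log(T/2π)+1)/(2πT)`, `E₂(T) = −∫_T^∞ φ'Q = 2∫_T^∞ Q/t³`).
[cite: BrentPlattTrudgian2021, §4 Example 1] -/
theorem BrentPlattTrudgian2021_example1_tendsto {T : ℝ} (hT : 2 * π ≤ T) :
    Tendsto (fun U ↦ ∑ ρ ∈ zerosBetween T U, (riemannZetaZeroOrder ρ : ℝ) * (1 / ρ.im ^ 2)) atTop
      (𝓝 ((Real.log (T / (2 * π)) + 1) / (2 * π * T)
        - ((zetaZeroCount T : ℝ) - countMain T) / T ^ 2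
        + 2 * ∫ t in Ioi T, ((zetaZeroCount t : ℝ) - countMain t) / t ^ 3)) := by
  have hπ : 3 < π := Real.pi_gt_three
  have hT0 : 0 < T := by linarith
  have h3 : (3 : ℝ) ≤ T := by linarith
  have h := BrentPlattTrudgian2021_thm1 h3 (BPT2021.hasDerivAt_one_div_sq hT0)
    (BPT2021.continuousOn_neg_two_div_cube hT0) (fun t ht ↦ by have := hT0.trans_le ht; positivity)
    (fun t ht ↦ by
      have := hT0.trans_le ht
      exact div_nonpos_of_nonpos_of_nonneg (by norm_num) (by positivity))
    (BPT2021.integrableOn_one_div_sq_mul_log hT)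
  rw [BPT2021.integral_Ioi_one_div_sq_mul_log hT, BPT2021.integral_Ioi_mul_neg_two_div_cube] at h
  convert h using 2
  field_simp
  ring

/-- **Example 1, the printed error bound**: for `T ≥ 2π`,
`|E₂(T)| = |2∫_T^∞ Q/t³| ≤ (8.334 + 0.236 log T)/T³`, GIVEN the two named facts behind the printed
constants `A₀ = 2.067`, `A₁ = 0.059` on `[2π,∞)` and `A₂ = 1/150` (`BrentPlattTrudgian2021_eq29`,
`BrentPlattTrudgian2021_lemma2`): `(4A₀ + A₁ + A₂) + 4A₁ log T ≤ 8.334 + 0.236 log T`.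
[cite: BrentPlattTrudgian2021, §4 Example 1] -/
theorem BrentPlattTrudgian2021_example1_E2 (h29 : BrentPlattTrudgian2021_eq29)
    (hL2 : BrentPlattTrudgian2021_lemma2) {T : ℝ} (hT : 2 * π ≤ T) :
    |2 * ∫ t in Ioi T, ((zetaZeroCount t : ℝ) - countMain t) / t ^ 3| ≤
      (8.334 + 0.236 * Real.log T) / T ^ 3 := by
  have hπ : 3 < π := Real.pi_gt_three
  have hT0 : 0 < T := by linarith
  have h3 : (3 : ℝ) ≤ T := by linarith
  have hlogT : 0 ≤ Real.log T := Real.log_nonneg (by linarith)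
  have hS1 : ∀ t ∈ Ici T, |∫ x in (168 * π)..t, zetaArgS x| ≤ 2.067 + 0.059 * Real.log t :=
    fun t ht ↦ h29 t (hT.trans ht)
  have hQS : ∀ t ∈ Ici T, |((zetaZeroCount t : ℝ) - countMain t) - zetaArgS t| ≤ (1 / 150) / t := by
    intro t ht
    have h := hL2 t (hT.trans ht)
    rwa [div_div]
  have h := BrentPlattTrudgian2021_thm1_E2 h3 (by norm_num : (0 : ℝ) ≤ 0.059)
    (BPT2021.hasDerivAt_one_div_sq hT0) (BPT2021.hasDerivAt_neg_two_div_cube hT0)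
    (BPT2021.continuousOn_six_div_pow_four hT0) (fun t ht ↦ by have := hT0.trans_le ht; positivity)
    (fun t ht ↦ by
      have := hT0.trans_le ht
      exact div_nonpos_of_nonpos_of_nonneg (by norm_num) (by positivity))
    (fun t ht ↦ by have := hT0.trans_le ht; positivity) (BPT2021.integrableOn_one_div_sq_div hT0)
    hS1 hQS
  rw [BPT2021.integral_Ioi_mul_neg_two_div_cube, abs_neg] at h
  have e1 : |(-2 : ℝ) / T ^ 3| = 2 / T ^ 3 := by
    rw [neg_div, abs_neg, abs_of_pos (by positivity)]
  rw [e1] at h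
  refine h.trans ?_
  rw [show 2 * (2.067 + 0.059 * Real.log T) * (2 / T ^ 3) + (0.059 + 1 / 150) * (1 / T ^ 2) / T =
      (4 * (2.067 + 0.059 * Real.log T) + (0.059 + 1 / 150)) / T ^ 3 by field_simp; ring]
  apply div_le_div_of_nonneg_right _ (by positivity)
  linarith

/-! ## The constant `c₁ = Σ_{γ>0} 1/γ²` -/

/-- **The constant `c₁ = Σ_{γ>0} 1/γ²` of Brent–Platt–Trudgian**, DEFINED by the closed form of their
Theorem 1/2 at `T = 2π`: `c₁ := 7/(32π²) + 2∫_{2π}^∞ Q(t)/t³ dt`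
(`(1/2π)∫_{2π}^∞ log(t/2π)/t² = 1/(4π²)`, `−Q(2π)/(2π)² = −1/(32π²)`). That it IS the sum is
`zetaZeroInvSqLimit_tendsto`; its value `0.0231049931154189707889338104 + ϑ(5·10⁻²⁸)` (Cor. 1) is
the content of the named fact `BrentPlattTrudgian2021_cor1`, see `BrentPlattTrudgian2021_cor1_iff`.
[cite: BrentPlattTrudgian2021, §4 Example 1 and Corollary 1] -/
def zetaZeroInvSqLimit : ℝ :=
  7 / (32 * π ^ 2) + 2 * ∫ t in Ioi (2 * π), ((zetaZeroCount t : ℝ) - countMain t) / t ^ 3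

/-- **`Σ_{0<γ≤U} m(ρ)/γ² → c₁`** as `U → ∞`. [cite: BrentPlattTrudgian2021, §4 Example 1 and Corollary 1] -/
theorem zetaZeroInvSqLimit_tendsto :
    Tendsto (fun U ↦ ∑ ρ ∈ zerosBetween 0 U, (riemannZetaZeroOrder ρ : ℝ) / ρ.im ^ 2) atTop
      (𝓝 zetaZeroInvSqLimit) := by
  have hπ : 3 < π := Real.pi_gt_three
  have h0 : (0 : ℝ) < 2 * π := by positivity
  have h := BrentPlattTrudgian2021_example1_tendsto (le_refl (2 * π))
  rw [div_self h0.ne', Real.log_one, BPT2021.count_sub_countMain_two_pi] at h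
  have e : ((0 : ℝ) + 1) / (2 * π * (2 * π)) - 1 / 8 / (2 * π) ^ 2
      + 2 * ∫ t in Ioi (2 * π), ((zetaZeroCount t : ℝ) - countMain t) / t ^ 3 = zetaZeroInvSqLimit := by
    rw [zetaZeroInvSqLimit]
    field_simp
    ring
  rw [e] at h
  refine h.congr' ?_
  filter_upwards [eventually_ge_atTop (2 * π)] with U hU
  rw [BPT2021.sum_zerosBetween_zero_eq hU]
  exact Finset.sum_congr rfl fun ρ _ ↦ by rw [mul_one_div]

/-- Truncations are non-decreasing in `U`. [cite: BrentPlattTrudgian2021, Corollary 1 (proof)] -/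
theorem monotone_sum_inv_sq :
    Monotone fun U : ℝ ↦ ∑ ρ ∈ zerosBetween 0 U, (riemannZetaZeroOrder ρ : ℝ) / ρ.im ^ 2 := by
  intro U U' h
  have hsub : zerosBetween 0 U ⊆ zerosBetween 0 U' := by
    intro ρ hρ
    obtain ⟨hz, h0, h1, h3, h4⟩ := (mem_zerosBetween le_rfl).1 hρ
    exact (mem_zerosBetween le_rfl).2 ⟨hz, h0, h1, h3, h4.trans h⟩
  show ∑ ρ ∈ zerosBetween 0 U, (riemannZetaZeroOrder ρ : ℝ) / ρ.im ^ 2 ≤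
    ∑ ρ ∈ zerosBetween 0 U', (riemannZetaZeroOrder ρ : ℝ) / ρ.im ^ 2
  refine Finset.sum_le_sum_of_subset_of_nonneg hsub fun ρ hρ _ ↦ ?_
  exact div_nonneg (zeroOrder_nonneg_of_mem_zerosBetween le_rfl hρ) (sq_nonneg _)

/-- **Every truncation is `≤ c₁`**: `Σ_{0<γ≤U} m(ρ)/γ² ≤ zetaZeroInvSqLimit`.
[cite: BrentPlattTrudgian2021, Corollary 1] -/
theorem sum_inv_sq_le_zetaZeroInvSqLimit (U : ℝ) :
    ∑ ρ ∈ zerosBetween 0 U, (riemannZetaZeroOrder ρ : ℝ) / ρ.im ^ 2 ≤ zetaZeroInvSqLimit :=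
  monotone_sum_inv_sq.ge_of_tendsto zetaZeroInvSqLimit_tendsto U

/-- The named fact `BrentPlattTrudgian2021_cor1` (every truncation `≤ c₁ + 5·10⁻²⁸`, truncations come
within any `ε` of `c₁ − 5·10⁻²⁸`, `c₁ = 0.0231049931154189707889338104`) is EQUIVALENT to the
enclosure `|zetaZeroInvSqLimit − c₁| ≤ 5·10⁻²⁸` of the defined constant.
[cite: BrentPlattTrudgian2021, Corollary 1] -/
theorem BrentPlattTrudgian2021_cor1_iff :
    BrentPlattTrudgian2021_cor1 ↔ |zetaZeroInvSqLimit - BPT2021.c₁| ≤ BPT2021.c₁err := by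
  have hlim := zetaZeroInvSqLimit_tendsto
  constructor
  · rintro ⟨hup, hlow⟩
    rw [abs_le]
    constructor
    · -- lower: for every ε, some truncation ≥ c₁ − err − ε, and truncations ≤ limit
      have h : ∀ ε : ℝ, 0 < ε → BPT2021.c₁ - BPT2021.c₁err - ε ≤ zetaZeroInvSqLimit := by
        intro ε hε
        obtain ⟨U, hU⟩ := hlow ε hε
        exact hU.trans (sum_inv_sq_le_zetaZeroInvSqLimit U)
      have : BPT2021.c₁ - BPT2021.c₁err ≤ zetaZeroInvSqLimit := by
        refine le_of_forall_pos_lt_add fun ε hε ↦ ?_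
        have := h (ε / 2) (by linarith)
        linarith
      linarith
    · have : zetaZeroInvSqLimit ≤ BPT2021.c₁ + BPT2021.c₁err :=
        le_of_tendsto' hlim fun U ↦ hup U
      linarith
  · intro h
    rw [abs_le] at h
    refine ⟨fun U ↦ (sum_inv_sq_le_zetaZeroInvSqLimit U).trans (by linarith), fun ε hε ↦ ?_⟩
    have hev : ∀ᶠ U in atTop, zetaZeroInvSqLimit - ε <
        ∑ ρ ∈ zerosBetween 0 U, (riemannZetaZeroOrder ρ : ℝ) / ρ.im ^ 2 :=
      hlim.eventually (lt_mem_nhds (by linarith))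
    obtain ⟨U, hU⟩ := hev.exists
    exact ⟨U, by linarith⟩

/-- **The identity behind a finite computation of `c₁`** (Theorem 3 with `φ = 1/t²`, `T₀ = 2π`): for
`T ≥ 2π`, `c₁ = Σ_{0<γ≤T} m(ρ)/γ² + (log(T/2π) + 1)/(2πT) − Q(T)/T² + 2∫_T^∞ Q(t)/t³ dt`.
[cite: BrentPlattTrudgian2021, Theorem 3 and §4 Example 1] -/
theorem zetaZeroInvSqLimit_eq_at {T : ℝ} (hT : 2 * π ≤ T) :
    zetaZeroInvSqLimit =
      ∑ ρ ∈ zerosBetween 0 T, (riemannZetaZeroOrder ρ : ℝ) / ρ.im ^ 2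
        + (Real.log (T / (2 * π)) + 1) / (2 * π * T) - ((zetaZeroCount T : ℝ) - countMain T) / T ^ 2
        + 2 * ∫ t in Ioi T, ((zetaZeroCount t : ℝ) - countMain t) / t ^ 3 := by
  have hπ : 3 < π := Real.pi_gt_three
  have hT0 : 0 < T := by linarith
  -- the tail sums converge to the bracket; the full sums converge to `c₁`; they differ by the finite sum
  have htail := BrentPlattTrudgian2021_example1_tendsto hT
  have hfull := zetaZeroInvSqLimit_tendsto
  have hsplit : ∀ᶠ U in atTop, ∑ ρ ∈ zerosBetween 0 U, (riemannZetaZeroOrder ρ : ℝ) / ρ.im ^ 2 =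
      ∑ ρ ∈ zerosBetween 0 T, (riemannZetaZeroOrder ρ : ℝ) / ρ.im ^ 2
        + ∑ ρ ∈ zerosBetween T U, (riemannZetaZeroOrder ρ : ℝ) * (1 / ρ.im ^ 2) := by
    filter_upwards [eventually_ge_atTop T] with U hU
    rw [SoundTest.sum_zerosBetween_split le_rfl hT0.le hU]
    congr 1
    exact Finset.sum_congr rfl fun ρ _ ↦ by rw [mul_one_div]
  have h2 := (tendsto_const_nhds (x := ∑ ρ ∈ zerosBetween 0 T, (riemannZetaZeroOrder ρ : ℝ) / ρ.im ^ 2)).add htail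
  have h3 := hfull.congr' hsplit
  have := tendsto_nhds_unique h3 h2
  rw [this]
  ring

end Literature.NumberTheory.LFunctions
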